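import Summits.Ventures.PercRepro.SixFourResidueThreeTwoPointsC

/-!
# The `t = 3` clause of `SixFourResidue` — plane + `k` points for EVERY plane size, part 1: the counts in line-sum form (p2, gen 9 — §21.18.3, §19.7 Step 3)

For `G = τ ⊔ {a}` (`k = 1`) or `τ ⊔ {a, a′}` (`k = 2`) with `τ = P₀ ∩ G` a rank-`3` plane trace of `p` points and lines of sizes
`m_λ` (2-point lines included), the share / demand bounds of `SixFourResidueThreeOnePoint` / `ThreeTwoPointsA–C` give, with
every count written as a constant plus a sum over the lines (`card_rank3_k_add_sum`, `D3_add_sum_delta`, `LPcnt_le_all`,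
`card_small_eq_sum`, `card_collPairs_all`, `card_R2_three_le_all`):

  `20·J₃(G) ≥ A20 k p + Σ_λ B20 k p m_λ`     (`J_three_ge_additive`)

with `A20 1 p = 12·C(p,3) + 30·δ(p) − 24·Σ_{3 ≤ j ≤ p−3} C(p,j)`,
`B20 1 p m = −12·C(m,3) − 30·δ(m) − 10·ε(m)(p − m) + 24·(Σ_{3 ≤ j ≤ p−3} C(m,j) + collCount m)`, and at `k = 2`
`A20 2 p = 39·C(p,3) + 120·δ(p) − 24·Σ_{j ≤ p−3} C(p,j) − 48·Σ_{j ≤ p−2} C(p,j) − 12·C(p,2)`,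
`B20 2 p m = −39·C(m,3) − 120·δ(m) − 50·ε(m)(p − m) + 24·(Σ_{j ≤ p−3} C(m,j) + collCount m) + 48·Σ_{j ≤ p−2} C(m,j) − 4·ε(m)`
(no size cap anywhere).  This file holds the definitions `smallTot`, `A20`, `B20` and the count lemmas; the additive bounds
`J_three_ge_additive₁` / `J_three_ge_additive₂` are `SixFourResidueThreeBetaAll.lean`, and `SixFourResidueThreeBetaLong.lean` /
`ThreeBetaTable.lean` turn them into Proposition 21.5 / Theorem 21.6 at `t = 3` for every `p ≤ 100` by the one-long-line bound.
-/

namespace PercRepro.SixFour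

/-- `Σ_{k ∈ [3, p − c]} C(n, k)` (the size-`k` window of the demand counts: `c = 3` for `dem₃`, `c = 2` for `dem₂`). -/
def smallTot (n p c : ℕ) : ℕ := ∑ j ∈ (Finset.range (p + 1)).filter (fun j => 3 ≤ j ∧ j + c ≤ p), n.choose j

/-- The constant of the additive bound (`20×`). -/
def A20 (k p : ℕ) : ℤ :=
  if k = 1 then 12 * (p.choose 3 : ℤ) + 30 * (delta p : ℤ) - 24 * (smallTot p p 3 : ℤ)
  else 39 * (p.choose 3 : ℤ) + 120 * (delta p : ℤ) - 24 * (smallTot p p 3 : ℤ) - 48 * (smallTot p p 2 : ℤ) - 12 * (p.choose 2 : ℤ)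

/-- The per-line term of the additive bound (`20×`). -/
def B20 (k p m : ℕ) : ℤ :=
  if k = 1 then
    -12 * (m.choose 3 : ℤ) - 30 * (delta m : ℤ) - 10 * (eps m : ℤ) * ((p - m : ℕ) : ℤ) + 24 * ((smallTot m p 3 : ℤ) + (collCount m : ℤ))
  else
    -39 * (m.choose 3 : ℤ) - 120 * (delta m : ℤ) - 50 * (eps m : ℤ) * ((p - m : ℕ) : ℤ) + 24 * ((smallTot m p 3 : ℤ) + (collCount m : ℤ)) +
      48 * (smallTot m p 2 : ℤ) - 4 * (eps m : ℤ)

open Finset ThmH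

variable {α : Type*} [DecidableEq α] {M : Matroid α} [M.Finite] {G : Finset α}

section Counts

variable (hs : Simple M) {τ : Finset α} (hτ : τ ⊆ gr M)
include hs hτ

/-- The rank-`3` `k`-subsets and the collinear `k`-subsets of a rank-`3` trace number `C(p,k)` together (`k ≥ 2`). -/
theorem card_rank3_k_add_sum (hr : M.eRk (τ : Set α) = 3) {k : ℕ} (hk : 2 ≤ k) :
    ((R3 M τ).filter (fun S => S.card = k)).card + ∑ L ∈ lines M, (L ∩ τ).card.choose k = τ.card.choose k := by
  have e1 : ((R3 M τ).filter (fun S => S.card = k)).card =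
      ((τ.powersetCard k).filter (fun Z : Finset α => M.eRk (Z : Set α) = 3)).card := by
    unfold R3
    rw [Finset.powersetCard_eq_filter, Finset.filter_filter, Finset.filter_filter]
    congr 1
    exact Finset.filter_congr (fun Z _ => and_comm)
  have hsplit := Finset.card_filter_add_card_filter_not (s := τ.powersetCard k)
    (fun Z : Finset α => M.eRk (Z : Set α) = 3)
  have hcongr : (τ.powersetCard k).filter (fun Z : Finset α => ¬ M.eRk (Z : Set α) = 3) =
      (τ.powersetCard k).filter (fun Z : Finset α => M.eRk (Z : Set α) = 2) := by
    refine Finset.filter_congr (fun Z hZ => ?_)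
    obtain ⟨hZτ, hc⟩ := Finset.mem_powersetCard.1 hZ
    have hle : M.eRk (Z : Set α) ≤ 3 := by rw [← hr]; exact M.eRk_mono (Finset.coe_subset.2 hZτ)
    constructor
    · intro hne
      refine le_antisymm ?_ (two_le_eRk_of_two_le_card hs hτ hZτ (by omega))
      by_contra h
      exact hne (eRk_eq_of_le_of_not_le (n := 2) hle h)
    · intro h2; rw [h2]; decide
  rw [hcongr, card_rank_two_subsets hs hτ hk, Finset.card_powersetCard] at hsplit
  rw [e1]
  exact hsplit

omit [DecidableEq α] hs hτ in
/-- `#{S ∈ R₃(τ) : |S| + c ≤ p} = Σ_{k ∈ [3, p − c]} #{S ∈ R₃(τ) : |S| = k}`. -/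
theorem card_small_eq_sum (c : ℕ) :
    ((R3 M τ).filter (fun S => S.card + c ≤ τ.card)).card =
      ∑ j ∈ (Finset.range (τ.card + 1)).filter (fun j => 3 ≤ j ∧ j + c ≤ τ.card), ((R3 M τ).filter (fun S => S.card = j)).card := by
  rw [Finset.card_eq_sum_card_fiberwise (f := fun S : Finset α => S.card)
    (t := (Finset.range (τ.card + 1)).filter (fun j => 3 ≤ j ∧ j + c ≤ τ.card))]
  · refine Finset.sum_congr rfl (fun j hj => ?_)
    rw [Finset.mem_filter, Finset.mem_range] at hj
    congr 1
    ext S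
    simp only [Finset.mem_filter]
    constructor
    · rintro ⟨⟨h1, -⟩, h3⟩; exact ⟨h1, h3⟩
    · rintro ⟨h1, h3⟩; exact ⟨⟨h1, by omega⟩, h3⟩
  · intro S hS
    rw [Finset.mem_coe, Finset.mem_filter] at hS
    obtain ⟨hSτ, hS3⟩ := mem_R3.1 hS.1
    have h3 : 3 ≤ S.card := three_le_card_of_eRk_eq_three hS3
    have hle := Finset.card_le_card hSτ
    show S.card ∈ (((Finset.range (τ.card + 1)).filter (fun j => 3 ≤ j ∧ j + c ≤ τ.card) : Finset ℕ) : Set ℕ)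
    rw [Finset.mem_coe, Finset.mem_filter, Finset.mem_range]
    exact ⟨by omega, h3, hS.2⟩

/-- The small count in line-sum form: `#{S ∈ R₃ : |S| + c ≤ p} = smallTot p p c − Σ_λ smallTot m_λ p c` (in `ℤ`). -/
theorem card_small_eq_all (hr : M.eRk (τ : Set α) = 3) (c : ℕ) :
    ((((R3 M τ).filter (fun S => S.card + c ≤ τ.card)).card : ℕ) : ℤ) =
      (smallTot τ.card τ.card c : ℤ) - ∑ L ∈ lines M, (smallTot (L ∩ τ).card τ.card c : ℤ) := by
  rw [card_small_eq_sum c]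
  unfold smallTot
  push_cast
  rw [Finset.sum_comm (s := lines M), ← Finset.sum_sub_distrib]
  refine Finset.sum_congr rfl (fun j hj => ?_)
  rw [Finset.mem_filter] at hj
  have h := card_rank3_k_add_sum hs hτ hr (k := j) (by omega)
  have h' : (((R3 M τ).filter (fun S => S.card = j)).card : ℤ) + ∑ L ∈ lines M, ((L ∩ τ).card.choose j : ℤ) =
      (τ.card.choose j : ℤ) := by exact_mod_cast h
  linarith

/-- `T = C(p,3) − Σ_λ C(m_λ, 3)` for every plane size. -/
theorem Tcnt_eq_all (hr : M.eRk (τ : Set α) = 3) :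
    (Tcnt M τ : ℤ) = (τ.card.choose 3 : ℤ) - ∑ L ∈ lines M, ((L ∩ τ).card.choose 3 : ℤ) := by
  have h := card_rank3_k_add_sum hs hτ hr (k := 3) (by norm_num)
  unfold Tcnt
  have h' : (((R3 M τ).filter (fun S => S.card = 3)).card : ℤ) + ∑ L ∈ lines M, ((L ∩ τ).card.choose 3 : ℤ) =
      (τ.card.choose 3 : ℤ) := by exact_mod_cast h
  linarith

/-- `D₃ = δ(p) − Σ_λ δ(m_λ)` for every plane size. -/
theorem D3cnt_eq_all (hr : M.eRk (τ : Set α) = 3) :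
    (D3cnt M τ : ℤ) = (delta τ.card : ℤ) - ∑ L ∈ lines M, (delta (L ∩ τ).card : ℤ) := by
  have e1 : D3cnt M τ = (τ.powerset.filter (fun Z : Finset α => 4 ≤ Z.card ∧ M.eRk (Z : Set α) = 3)).card := by
    unfold D3cnt R3
    rw [Finset.filter_filter]
    congr 1
    exact Finset.filter_congr (fun Z _ => and_comm)
  have hD := D3_add_sum_delta hs hτ hr
  rw [← e1] at hD
  have h' : (D3cnt M τ : ℤ) + ∑ L ∈ lines M, (delta (L ∩ τ).card : ℤ) = (delta τ.card : ℤ) := by exact_mod_cast hD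
  linarith

/-- `LP ≤ Σ_λ ε(m_λ)·(p − m_λ)` for every plane size (the surjection of `LPcnt_le`, not truncated). -/
theorem LPcnt_le_all :
    (LPcnt M τ : ℤ) ≤ ∑ L ∈ lines M, (eps (L ∩ τ).card : ℤ) * ((τ.card - (L ∩ τ).card : ℕ) : ℤ) := by
  set T := (lines M).sigma (fun L => ((L ∩ τ).powerset.filter (fun C : Finset α => 3 ≤ C.card)) ×ˢ (τ \ L)) with hT
  have hsurj : Set.SurjOn (fun q : Σ _ : Finset α, Finset α × α => insert q.2.2 q.2.1) (T : Set _)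
      (((R3 M τ).filter (fun S => 4 ≤ S.card ∧ kcol M S = 1)) : Set (Finset α)) := by
    intro S hS
    rw [Finset.mem_coe, Finset.mem_filter] at hS
    obtain ⟨hS3, h4, hk⟩ := hS
    obtain ⟨hSτ, hr3⟩ := mem_R3.1 hS3
    unfold kcol at hk
    obtain ⟨y, hy⟩ := Finset.card_eq_one.1 hk
    have hyS : y ∈ S ∧ M.eRk ((S.erase y : Finset α) : Set α) ≤ 2 :=
      Finset.mem_filter.1 (hy ▸ Finset.mem_singleton_self y)
    have hCτ : S.erase y ⊆ τ := (Finset.erase_subset y S).trans hSτ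
    have hC3 : 3 ≤ (S.erase y).card := by rw [Finset.card_erase_of_mem hyS.1]; omega
    have hCr : M.eRk ((S.erase y : Finset α) : Set α) = 2 :=
      le_antisymm hyS.2 (two_le_eRk_of_two_le_card hs hτ hCτ (by omega))
    have hL := clF_mem_lines (hCτ.trans hτ) hCr
    refine ⟨⟨clF M (S.erase y), (S.erase y, y)⟩, ?_, ?_⟩
    · rw [Finset.mem_coe, hT, Finset.mem_sigma, Finset.mem_product, Finset.mem_filter, Finset.mem_powerset,
        Finset.mem_sdiff]
      refine ⟨hL.1, ⟨Finset.subset_inter hL.2 hCτ, hC3⟩, hSτ hyS.1, ?_⟩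
      intro hyL
      have hsub : (S : Set α) ⊆ M.closure ((S.erase y : Finset α) : Set α) := by
        intro z hz
        rw [Finset.mem_coe] at hz
        by_cases hzy : z = y
        · subst hzy
          rw [← coe_clF]
          exact Finset.mem_coe.2 hyL
        · exact M.subset_closure _ (by rw [← coe_gr]; exact_mod_cast hCτ.trans hτ)
            (Finset.mem_coe.2 (Finset.mem_erase.2 ⟨hzy, hz⟩))
      have h3 : M.eRk (S : Set α) ≤ 2 := by
        calc M.eRk (S : Set α) ≤ M.eRk (M.closure ((S.erase y : Finset α) : Set α)) := M.eRk_mono hsub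
          _ = M.eRk ((S.erase y : Finset α) : Set α) := M.eRk_closure_eq _
          _ ≤ 2 := hyS.2
      rw [hr3] at h3
      exact absurd h3 (by decide)
    · simp only
      exact Finset.insert_erase hyS.1
  have hcard : LPcnt M τ ≤ T.card := Finset.card_le_card_of_surjOn _ hsurj
  have hTcard : T.card = ∑ L ∈ lines M, eps (L ∩ τ).card * (τ.card - (L ∩ τ).card) := by
    rw [hT, Finset.card_sigma]
    refine Finset.sum_congr rfl (fun L _ => ?_)
    rw [Finset.card_product, card_powerset_filter_three_le]
    congr 1
    have := Finset.card_sdiff_add_card_inter τ L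
    rw [Finset.inter_comm] at this
    omega
  rw [hTcard] at hcard
  have hz := (Nat.cast_le (α := ℤ)).2 hcard
  push_cast at hz
  exact hz

omit hs hτ in
/-- `#collPairs = Σ_λ collCount m_λ` for every plane size. -/
theorem card_collPairs_all : ((collPairs M τ).card : ℤ) = ∑ L ∈ lines M, (collCount (L ∩ τ).card : ℤ) := by
  have hT : (collPairs M τ).card = ∑ L ∈ lines M, collCount (L ∩ τ).card := by
    unfold collPairs
    rw [Finset.card_sigma]
    refine Finset.sum_congr rfl (fun L _ => ?_)
    rw [card_powerset_filter_coll]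
  rw [hT]
  push_cast
  rfl

/-- **The refined `dem₃` count for every plane size**: `Σ dem₃ + Σ_λ collCount m_λ ≤ #{S ∈ R₃(τ) : |S| + 3 ≤ p}`. -/
theorem dem3_sum_add_collSum_le (hr : M.eRk (τ : Set α) = 3) :
    ∑ S ∈ R3 M τ, dem3 M τ S + ∑ L ∈ lines M, ((collCount (L ∩ τ).card : ℤ) : ℚ) ≤
      (((R3 M τ).filter (fun S => S.card + 3 ≤ τ.card)).card : ℚ) := by
  set A := (R3 M τ).filter (fun S => S.card + 3 ≤ τ.card) with hA
  set q : Finset α → Prop := fun S => M.eRk ((τ \ S : Finset α) : Set α) + 1 ≤ 3 with hqdef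
  have hdem : ∑ S ∈ R3 M τ, dem3 M τ S ≤ ((A.filter (fun S => ¬ q S)).card : ℚ) := by
    have hpt : ∀ S ∈ R3 M τ, dem3 M τ S ≤ (if S.card + 3 ≤ τ.card ∧ ¬ q S then (1 : ℚ) else 0) := by
      intro S hS
      obtain ⟨hSτ, -⟩ := mem_R3.1 hS
      unfold dem3
      split_ifs with h1 h2 h2
      · norm_num
      · norm_num
      · norm_num
      · exfalso
        apply h2
        refine ⟨?_, h1⟩
        by_contra hc
        apply h1
        have hle := M.eRk_le_encard ((τ \ S : Finset α) : Set α)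
        rw [Set.encard_coe_eq_coe_finsetCard, Finset.card_sdiff_of_subset hSτ] at hle
        have hc' : τ.card - S.card ≤ 2 := by omega
        calc M.eRk ((τ \ S : Finset α) : Set α) + 1 ≤ ((τ.card - S.card : ℕ) : ℕ∞) + 1 := add_le_add_left hle 1
          _ ≤ ((2 : ℕ) : ℕ∞) + 1 := add_le_add_left (by exact_mod_cast hc') 1
          _ = 3 := by norm_num
    refine (Finset.sum_le_sum hpt).trans ?_
    rw [Finset.sum_ite, Finset.sum_const, Finset.sum_const_zero, add_zero, nsmul_eq_mul, mul_one]
    rw [hA, Finset.filter_filter]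
  have hcoll : ∑ L ∈ lines M, ((collCount (L ∩ τ).card : ℤ) : ℚ) ≤ ((A.filter q).card : ℚ) := by
    have h1 : (collPairs M τ).card ≤ (A.filter q).card := by
      refine Finset.card_le_card_of_injOn (fun p : Σ _ : Finset α, Finset α => τ \ p.2) (fun p hp => ?_)
        (collPairs_injOn hs)
      rw [Finset.mem_coe] at hp
      have := sdiff_mem_of_collPair hs hτ hr hp
      rw [Finset.mem_filter] at this
      show τ \ p.2 ∈ ((A.filter q : Finset (Finset α)) : Set (Finset α))
      rw [Finset.mem_coe, Finset.mem_filter, hA, Finset.mem_filter]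
      exact ⟨⟨this.1, this.2.1⟩, this.2.2⟩
    have h2 := card_collPairs_all (M := M) (τ := τ)
    have h1' : ((collPairs M τ).card : ℤ) ≤ ((A.filter q).card : ℤ) := by exact_mod_cast h1
    rw [h2] at h1'
    have h1'' : ((∑ L ∈ lines M, (collCount (L ∩ τ).card : ℤ) : ℤ) : ℚ) ≤ (((A.filter q).card : ℤ) : ℚ) := by
      exact_mod_cast h1'
    push_cast at h1''
    exact h1''
  have hsplit : (A.filter q).card + (A.filter (fun S => ¬ q S)).card = A.card :=
    Finset.card_filter_add_card_filter_not (s := A) q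
  have hsplit' : ((A.filter q).card : ℚ) + ((A.filter (fun S => ¬ q S)).card : ℚ) = (A.card : ℚ) := by
    exact_mod_cast hsplit
  linarith

omit hs in
/-- `#{L′ ∈ R₂(τ) : |L′| ≥ 3} ≤ Σ_λ ε(m_λ)` for every plane size. -/
theorem card_R2_three_le_all :
    ((((R2 M τ).filter (fun L => 3 ≤ L.card)).card : ℕ) : ℤ) ≤ ∑ L ∈ lines M, (eps (L ∩ τ).card : ℤ) := by
  set T := (lines M).sigma (fun L => (L ∩ τ).powerset.filter (fun C : Finset α => 3 ≤ C.card)) with hT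
  have hsurj : Set.SurjOn (fun q : Σ _ : Finset α, Finset α => q.2) (T : Set _)
      (((R2 M τ).filter (fun L => 3 ≤ L.card)) : Set (Finset α)) := by
    intro S hS
    rw [Finset.mem_coe, Finset.mem_filter] at hS
    obtain ⟨hS2, h3⟩ := hS
    obtain ⟨hSτ, hr2⟩ := mem_R2.1 hS2
    have hL := clF_mem_lines (hSτ.trans hτ) hr2
    refine ⟨⟨clF M S, S⟩, ?_, rfl⟩
    rw [Finset.mem_coe, hT, Finset.mem_sigma, Finset.mem_filter, Finset.mem_powerset]
    exact ⟨hL.1, Finset.subset_inter hL.2 hSτ, h3⟩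
  have hcard : ((R2 M τ).filter (fun L => 3 ≤ L.card)).card ≤ T.card := Finset.card_le_card_of_surjOn _ hsurj
  have hTcard : T.card = ∑ L ∈ lines M, eps (L ∩ τ).card := by
    rw [hT, Finset.card_sigma]
    refine Finset.sum_congr rfl (fun L _ => ?_)
    rw [card_powerset_filter_three_le]
  rw [hTcard] at hcard
  have hz := (Nat.cast_le (α := ℤ)).2 hcard
  push_cast at hz
  exact hz

omit hs in
/-- **The β-sum for every plane size**: `−(3/5)·C(p, 2) − (1/5)·Σ_λ ε(m_λ) ≤ Σ_{L′ ∈ R₂(τ)} β(L′)`. -/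
theorem beta_sum_ge_all :
    -(3 / 5 : ℚ) * (τ.card.choose 2 : ℚ) - 1 / 5 * ∑ L ∈ lines M, ((eps (L ∩ τ).card : ℤ) : ℚ) ≤
      ∑ L ∈ R2 M τ, betaLB L := by
  have hsplit : ∑ L ∈ R2 M τ, betaLB L =
      ∑ L ∈ (R2 M τ).filter (fun L => L.card = 2), (-3 / 5 : ℚ) +
        ∑ L ∈ (R2 M τ).filter (fun L => ¬ L.card = 2), (-1 / 5 : ℚ) := by
    unfold betaLB
    rw [Finset.sum_ite]
  rw [hsplit, Finset.sum_const, Finset.sum_const, nsmul_eq_mul, nsmul_eq_mul]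
  have hA : (((R2 M τ).filter (fun L => L.card = 2)).card : ℚ) ≤ τ.card.choose 2 := by
    exact_mod_cast card_R2_two_le (M := M) (τ := τ)
  have hB : (((R2 M τ).filter (fun L => ¬ L.card = 2)).card : ℚ) ≤ ∑ L ∈ lines M, ((eps (L ∩ τ).card : ℤ) : ℚ) := by
    have heq : (R2 M τ).filter (fun L => ¬ L.card = 2) = (R2 M τ).filter (fun L => 3 ≤ L.card) := by
      refine Finset.filter_congr (fun L hL => ?_)
      have h2 : 2 ≤ L.card := by
        obtain ⟨-, hL2⟩ := mem_R2.1 hL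
        by_contra h
        have hle := M.eRk_le_encard (L : Set α)
        rw [Set.encard_coe_eq_coe_finsetCard, hL2] at hle
        have : L.card ≤ 1 := by omega
        have h1 : ((L.card : ℕ) : ℕ∞) ≤ 1 := by exact_mod_cast this
        exact absurd (hle.trans h1) (by decide)
      omega
    rw [heq]
    have h := card_R2_three_le_all (M := M) hτ
    have h' : (((((R2 M τ).filter (fun L => 3 ≤ L.card)).card : ℕ) : ℤ) : ℚ) ≤
        ((∑ L ∈ lines M, (eps (L ∩ τ).card : ℤ) : ℤ) : ℚ) := by exact_mod_cast h
    push_cast at h' ⊢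
    exact h'
  nlinarith

end Counts

end PercRepro.SixFour
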